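import Mathlib
import Summits.Ventures.PercRepro2.Defs
import Summits.Ventures.PercRepro2.Independence
import Summits.Ventures.PercRepro2.Harris
import Summits.Ventures.PercRepro2.Graph
import Summits.Ventures.PercRepro2.Exploration
import Summits.Ventures.PercRepro2.Events
import Summits.Ventures.PercRepro2.GateCylinder
import Summits.Ventures.PercRepro2.CDRequired
import Summits.Ventures.PercRepro2.CutVertexDefs
import Summits.Ventures.PercRepro2.CDCutVertex
import Summits.Ventures.PercRepro2.CDNestedInternal
import Summits.Ventures.PercRepro2.CDNestedRoutes
import Summits.Ventures.PercRepro2.CDNestedFan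
import Summits.Ventures.PercRepro2.CDNestedFanGraph
import Summits.Ventures.PercRepro2.CDNestedZeroOff
import Summits.Ventures.PercRepro2.CDCutAC

/-!
# Row 2′CD on a fan with an arbitrary graph hanging at its hub (blind cell PercRepro2, mine-a g36;
MINE-A.md §91.7)

The fan `F_m`: the path `x 0 – x 1 – … – x m` (rungs `r j = {x j, x (j+1)}`) with every `x i` joined to
the hub `v` by the spoke `c i = {x i, v}`; `a₁ = x 0`.  Let an ARBITRARY graph hang at the hub (`v` a cut
vertex, `CutV.IsCut ends v VA VB EA EB`, the near side `EA` consisting of rungs and spokes), let `a₂` and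
`o` lie on the fan (or at the hub) and `a₃` anywhere beyond the hub.  Then row 2′CD holds for every up-set
and every admissible weight vector (`cd_of_fan_pocket`) — the first hypothesis-free family with an
arbitrary pocket.

Proof.  `CDCutAC.cd_of_cut_far` needs (AC) at `(x 0, a₂, v, o)` under the vector with the far side
closed, for every up-set.  On the configurations closed off `EA` every open edge is a rung or a spoke,
so `fan_route_of_conn'` (`CDNestedFan.fan_route_of_conn` with the rung-or-spoke hypothesis on the OPEN
edges only) gives the route hypothesis of `CDNestedZeroOff.ac_of_nested_routes_zeroOff` for the fan
routes `{r 0, …, r (i-1), c i}` (`ac_of_fan_zeroOff`, the route bookkeeping of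
`CDNestedFan.cd_of_fan_bdd`).  No definition; one seat.
-/

namespace Summit.Ventures.PercRepro2

namespace CDFanPocket

section Graph

variable {V : Type*} {E : Type*} [DecidableEq E]

/-- **On a fan, `x 0 ↔ v` opens a route — for a configuration whose OPEN edges are rungs or spokes**
(`CDNestedFan.fan_route_of_conn` with the hypothesis on the open edges only). -/
lemma fan_route_of_conn' {ends : E → Sym2 V} {v : V} {m : ℕ} {x : ℕ → V} {r c : ℕ → E}
    (hr : ∀ j, j < m → ends (r j) = s(x j, x (j + 1))) (hc : ∀ i, i ≤ m → ends (c i) = s(x i, v))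
    (hx : ∀ i j, i ≤ m → j ≤ m → x i = x j → i = j) (hv : ∀ i, i ≤ m → x i ≠ v) {ω : Config E}
    (hE : ∀ e : E, ω e = true → (∃ j, j < m ∧ e = r j) ∨ (∃ i, i ≤ m ∧ e = c i))
    (h : Conn ends ω (x 0) v) :
    ∃ i, i < m + 1 ∧ ω ∈ GateCylinder.cylinder (insert (c i) ((Finset.range i).image r)) := by
  -- the invariant: at `x j` with the rungs before it open, or some route open
  let P : Set V := {w | (∃ j, j ≤ m ∧ w = x j ∧ ∀ j', j' < j → ω (r j') = true) ∨
    (∃ i, i ≤ m ∧ ω (c i) = true ∧ ∀ j', j' < i → ω (r j') = true)}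
  have hP : v ∈ P := by
    refine mem_of_conn_of_closed (ends := ends) (ω := ω) (S := P) ?_ ?_ h
    · intro u hu w huw
      obtain ⟨_, e, he, hends⟩ := openGraph_adj.1 huw
      rcases hu with ⟨j, hj, rfl, hrungs⟩ | hroute
      · rcases hE e he with ⟨j', hj', rfl⟩ | ⟨i, hi, rfl⟩
        · -- a rung at `x j`: `j' = j` (forward) or `j' + 1 = j` (backward)
          rw [hr j' hj', Sym2.eq_iff] at hends
          rcases hends with ⟨h1, rfl⟩ | ⟨rfl, h2⟩
          · have hjj : j' = j := hx j' j (by omega) hj h1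
            subst hjj
            refine Or.inl ⟨j' + 1, by omega, rfl, fun j'' hj'' => ?_⟩
            rcases Nat.lt_succ_iff_lt_or_eq.1 hj'' with hlt | rfl
            · exact hrungs j'' hlt
            · exact he
          · have hjj : j' + 1 = j := hx (j' + 1) j (by omega) hj h2
            exact Or.inl ⟨j', by omega, rfl, fun j'' hj'' => hrungs j'' (by omega)⟩
        · -- a spoke at `x j`: it is `c j`, and the route `j` is open
          rw [hc i hi, Sym2.eq_iff] at hends
          rcases hends with ⟨h1, rfl⟩ | ⟨_, h2⟩
          · have hij : i = j := hx i j hi hj h1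
            subst hij
            exact Or.inr ⟨i, hi, he, hrungs⟩
          · exact absurd h2.symm (hv j hj)
      · exact Or.inr hroute
    · exact Or.inl ⟨0, Nat.zero_le m, rfl, fun j' hj' => absurd hj' (Nat.not_lt_zero j')⟩
  rcases hP with ⟨j, hj, hja, _⟩ | ⟨i, hi, hci, hrungs⟩
  · exact absurd hja.symm (hv j hj)
  · exact ⟨i, by omega, CDNestedFan.mem_fanCylinder_iff.2 ⟨hci, hrungs⟩⟩

end Graph

section Theorem

variable {V : Type*} {E : Type*} [Fintype E] [DecidableEq E] [Fintype V] [DecidableEq V]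
  {R : Type*} [Field R] [LinearOrder R] [IsStrictOrderedRing R]

/-- **(AC) on a fan under a vector supported by rungs and spokes**: if every edge of `F` is a rung or a
spoke of the fan with hub `v`, then (AC) holds at `(x 0, a₂, v, o)` under `p[off F ↦ 0]` for every up-set
— whatever the edges off `F` are. -/
theorem ac_of_fan_zeroOff (p : E → R) (hp : IsProbVec p) (F : Set E) [DecidablePred (· ∈ F)]
    {ends : E → Sym2 V} {v : V} (a₂ o : V) (m : ℕ) (x : ℕ → V) (r c : ℕ → E)
    (hr : ∀ j, j < m → ends (r j) = s(x j, x (j + 1))) (hc : ∀ i, i ≤ m → ends (c i) = s(x i, v))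
    (hx : ∀ i j, i ≤ m → j ≤ m → x i = x j → i = j) (hv : ∀ i, i ≤ m → x i ≠ v)
    (hF : ∀ e : E, e ∈ F → (∃ j, j < m ∧ e = r j) ∨ (∃ i, i ≤ m ∧ e = c i))
    {𝓔 : Set (Set V)} (h𝓔 : IsUpperSet 𝓔) :
    prob (fun e => if e ∈ F then p e else 0) ((connEvent ends (x 0) a₂)ᶜ ∩
          clusterInEvent ends (x 0) 𝓔 ∩ connEvent ends (x 0) v ∩ connEvent ends a₂ o) *
        prob (fun e => if e ∈ F then p e else 0) ((connEvent ends (x 0) a₂)ᶜ ∩ connEvent ends (x 0) v) ≤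
      prob (fun e => if e ∈ F then p e else 0) ((connEvent ends (x 0) a₂)ᶜ ∩
          clusterInEvent ends (x 0) 𝓔 ∩ connEvent ends (x 0) v) *
        prob (fun e => if e ∈ F then p e else 0) ((connEvent ends (x 0) a₂)ᶜ ∩ connEvent ends (x 0) v ∩
          connEvent ends a₂ o) := by
  set L : ℕ → List (E × V × V) :=
    fun i => (List.range i).map (fun j => (r j, x j, x (j + 1))) ++ [(c i, x i, v)] with hL
  have hmem : ∀ i t, t ∈ L i ↔ (∃ j < i, (r j, x j, x (j + 1)) = t) ∨ t = (c i, x i, v) := by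
    intro i t
    simp [hL, List.mem_append, List.mem_map, List.mem_range]
  have hB : ∀ i, i < m + 1 →
      insert (c i) ((Finset.range i).image r) = (L i).foldl (fun acc t => insert t.1 acc) ∅ := by
    intro i _
    ext b
    rw [CDNestedInternal.mem_foldl_insert_edges]
    simp only [Finset.mem_insert, Finset.mem_image, Finset.mem_range, Finset.notMem_empty, false_or,
      hmem]
    constructor
    · rintro (rfl | ⟨j, hj, rfl⟩)
      · exact ⟨(c i, x i, v), Or.inr rfl, rfl⟩
      · exact ⟨(r j, x j, x (j + 1)), Or.inl ⟨j, hj, rfl⟩, rfl⟩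
    · rintro ⟨t, (⟨j, hj, rfl⟩ | rfl), rfl⟩
      · exact Or.inr ⟨j, hj, rfl⟩
      · exact Or.inl rfl
  have hends : ∀ i, i < m + 1 → ∀ t ∈ L i, ends t.1 = s(t.2.1, t.2.2) := by
    intro i hi t ht
    rcases (hmem i t).1 ht with ⟨j, hj, rfl⟩ | rfl
    · exact hr j (by omega)
    · exact hc i (by omega)
  have hchain : ∀ i, List.IsChain (fun t u : E × V × V => u.2.1 = t.2.2) (L i) := by
    intro i
    rw [List.isChain_iff_getElem]
    intro j hj
    simp only [hL, List.length_append, List.length_map, List.length_range,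
      List.length_singleton] at hj
    have hji : j < i := by omega
    by_cases hj1 : j + 1 < i
    · simp [hL, hji, hj1]
    · have hi : i = j + 1 := by omega
      subst hi
      simp [hL]
  have hhead : ∀ i, ∀ t ∈ (L i).head?, t.2.1 ∈ ({x 0} : Finset V) := by
    intro i t ht
    rcases i with _ | i
    · simp only [hL, List.range_zero, List.map_nil, List.nil_append, List.head?_cons,
        Option.mem_def, Option.some.injEq] at ht
      subst ht
      simp
    · simp only [hL, List.range_succ_eq_map, List.map_cons, List.cons_append, List.head?_cons,
        Option.mem_def, Option.some.injEq] at ht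
      subst ht
      simp
  have hwalk : ∀ i, i < m + 1 → ∀ j (hj : j < (L i).length), ((L i).get ⟨j, hj⟩).2.1 ∈
      ({x 0} : Finset V) ∪ (((L i).take j).map (fun u => u.2.2)).toFinset :=
    fun i _ => CDNestedFan.walk_of_isChain (L i) {x 0} (hhead i) (hchain i)
  have h3 : ∀ i, i < m + 1 → v ∈ (L i).foldl (fun acc t => insert t.2.2 acc) ({x 0} : Finset V) := by
    intro i _
    rw [CDNestedFan.mem_foldl_insert_verts]
    exact Or.inr ⟨(c i, x i, v), (hmem i _).2 (Or.inr rfl), rfl⟩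
  have hnest : ∀ l i, l < i → i < m + 1 →
      (L l).foldl (fun acc t => insert t.2.2 acc) ({x 0} : Finset V) ⊆
        (L i).foldl (fun acc t => insert t.2.2 acc) ({x 0} : Finset V) := by
    intro l i hli _ w hw
    rw [CDNestedFan.mem_foldl_insert_verts] at hw ⊢
    rcases hw with hw | ⟨t, ht, rfl⟩
    · exact Or.inl hw
    · rcases (hmem l t).1 ht with ⟨j, hj, rfl⟩ | rfl
      · exact Or.inr ⟨(r j, x j, x (j + 1)), (hmem i _).2 (Or.inl ⟨j, by omega, rfl⟩), rfl⟩
      · exact Or.inr ⟨(c i, x i, v), (hmem i _).2 (Or.inr rfl), rfl⟩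
  refine CDNestedZeroOff.ac_of_nested_routes_zeroOff p hp F (m + 1) L
    (fun i => insert (c i) ((Finset.range i).image r))
    (fun i => (L i).foldl (fun acc t => insert t.2.2 acc) {x 0}) hB (fun _ _ => rfl) hends hwalk h3
    hnest h𝓔 ?_
  intro ω hω _ hconn
  refine fan_route_of_conn' hr hc hx hv ?_ hconn
  intro e he
  by_contra hcon
  have heF : e ∉ F := fun hin => hcon (hF e hin)
  rw [hω e heF] at he
  exact Bool.false_ne_true he

/-- **Row 2′CD on a fan with an arbitrary graph hanging at its hub.** The fan `x 0 – … – x m` with hub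
`v` (rungs `r j`, spokes `c i`; path vertices distinct, hub off the path) is the near side of the cut
vertex `v` (`h`; every near-side edge is a rung or a spoke), `a₂` and `o` lie on the fan or at the hub,
`a₃` anywhere beyond the hub: the row holds at `(x 0, a₂, a₃, o)` for every up-set and every admissible
weight vector, whatever hangs at the hub. -/
theorem cd_of_fan_pocket (p : E → R) (hp : IsProbVec p) {ends : E → Sym2 V} {v : V} {VA VB : Set V}
    {EA EB : Set E} [DecidablePred (· ∈ EA)] [DecidablePred (· ∈ EB)]
    (h : CutV.IsCut ends v VA VB EA EB) {a₂ a₃ o : V} (m : ℕ) (x : ℕ → V) (r c : ℕ → E)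
    (hr : ∀ j, j < m → ends (r j) = s(x j, x (j + 1))) (hc : ∀ i, i ≤ m → ends (c i) = s(x i, v))
    (hx : ∀ i j, i ≤ m → j ≤ m → x i = x j → i = j) (hv : ∀ i, i ≤ m → x i ≠ v)
    (hEA : ∀ e : E, e ∈ EA → (∃ j, j < m ∧ e = r j) ∨ (∃ i, i ≤ m ∧ e = c i))
    (hc0 : c 0 ∈ EA) (ha₂ : a₂ ∈ VA ∪ {v}) (ho : o ∈ VA ∪ {v}) (ha₃ : a₃ ∈ VB)
    {𝓔 : Set (Set V)} (h𝓔 : IsUpperSet 𝓔) :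
    let Q := (connEvent ends (x 0) a₂)ᶜ
    let U := clusterInEvent ends (x 0) 𝓔
    let e := connEvent ends (x 0) a₃
    let f := connEvent ends a₂ o
    let N := (connEvent ends (x 0) a₃)ᶜ ∩ (connEvent ends a₂ a₃)ᶜ
    let oU := connEvent ends (x 0) o ∪ connEvent ends a₂ o
    prob p (Q ∩ N) * (prob p Q * prob p (Q ∩ U ∩ e ∩ f) - prob p (Q ∩ U) * prob p (Q ∩ e ∩ f)) ≤
      prob p (Q ∩ N ∩ oU) * (prob p Q * prob p (Q ∩ U ∩ e) - prob p (Q ∩ U) * prob p (Q ∩ e)) := by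
  have hx0 : x 0 ∈ VA ∪ {v} := (h.ends_mem_of_mem_EA hc0 (hc 0 (Nat.zero_le m))).1
  exact CDCutAC.cd_of_cut_far p hp h hx0 ha₂ ho ha₃ h𝓔 fun _ h𝓤 =>
    ac_of_fan_zeroOff p hp EA a₂ o m x r c hr hc hx hv hEA h𝓤

end Theorem

end CDFanPocket

end Summit.Ventures.PercRepro2
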